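import Summits.Parity.GeneralizedHardyLittlewood.Theorems.GreenTaoLevelTwoMNTwoAlmostLinearClass

/-!
# Route `GreenTaoLevelTwo`, crux `MNTwo` (stmt-Parity-21276), line `birth`, stub `stub_mnVertical`:
# Möbius is orthogonal to almost linear phases (GT 2008b Prop. 15, abstract form, assembled)

Block V2 of the `stub_mnVertical` census, assembly part 2 (B. Green, T. Tao, *Quadratic uniformity
of the Möbius function*, Ann. Inst. Fourier 58 (2008) = arXiv:math/0606087, §6 Proposition 15
"Orthogonality to almost linear phases on Bohr sets": "`|𝔼_{N<n≤2N} μ(n)ψ(n)e(−φ(n))| ≪_{A,G/Γ}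
κ^{-O(1)} q³ log^{-A} N + (ε + κ) 𝔼|ψ|` … By the triangle inequality it suffices to show [the bound]
for all `s`, `1 ≤ s ≤ q`").  Summing the one-class estimate `…MNTwoAlmostLinearClass.norm_sum_class_le`
(with `p = 10N` and the Davenport input `…MNTwoMoebiusTransfer.norm_sum_moebius_block_progression_le`)
over the `q` residue classes gives Prop. 15 in ABSTRACT form: the Bohr set `{h ∈ B_g(0,κ) : q ∣ h}`
is replaced by any finite set `H ∋ 0` of shifts with `|h| ≤ N`, `q ∣ h`, `#H ≥ δN` (for the Bohr set,
`δ ≫ κ^{O(1)}/q` by Lemma 14 (a),(c) = `…MNTwoRotationBohr{Size,Divisible}`), and the Lipschitz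
hypothesis on `ψ` by the shift bound `|ψ(n+h₁+h₂) − ψ(n)| ≤ w(n)`.  Def-free.

* `sum_Ioc_eq_sum_mod_sum_filter` — splitting `Σ_{(N,2N]}` by residues mod `q`;
* `norm_sum_moebius_almost_linear_le` — **Prop. 15 (abstract)**: for every `A > 0` there is `C ≥ 0`
  with `‖Σ_{N<n≤2N} μ(n)ψ(n)e(−φ(n))‖ ≤ C q/√δ · N/log^A N + 6πε Σψ + Σ_{(N,2N]} w`.

References: [GreenTao2008QuadraticMobius] arXiv:math/0606087 §6, Proposition 15.
-/

noncomputable section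

open Finset Real ArithmeticFunction
open scoped ArithmeticFunction.Moebius

namespace Summit.Parity.GeneralizedHardyLittlewood.GreenTaoLevelTwoMNTwoAlmostLinear

open Summit.Parity.GeneralizedHardyLittlewood.GreenTaoLevelTwoMNTwoMoebiusTransfer
  (norm_sum_moebius_block_progression_le)
open Summit.Parity.GeneralizedHardyLittlewood.GreenTaoLevelTwoMNTwoAlmostLinearClass
  (norm_sum_class_le)

/-! ### §1 Splitting into residue classes -/


/-- Splitting a sum over `(N, 2N]` by residues modulo `q ≥ 1`. [folklore] -/
theorem sum_Ioc_eq_sum_mod_sum_filter {M : Type*} [AddCommMonoid M] {q : ℕ} (hq : 1 ≤ q) (N : ℕ)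
    (G : ℕ → M) :
    ∑ n ∈ Ioc N (2 * N), G n =
      ∑ r ∈ range q, ∑ n ∈ (Ioc N (2 * N)).filter (fun n : ℕ => n % q = r), G n := by
  rw [← Finset.sum_fiberwise_of_maps_to (s := Ioc N (2 * N)) (t := range q) (g := fun n : ℕ => n % q)
    (fun n _ => mem_range.2 (Nat.mod_lt n (by omega)))]

/-! ### §2 Proposition 15, abstract form -/

/-- **Möbius is orthogonal to almost linear phases (GT 2008b Prop. 15, abstract form).**  For every
`A > 0` there is `C ≥ 0` such that: for `N ≥ 2`, `q ≥ 1`, a finite set of admissible shifts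
`H ∋ 0` (`|h| ≤ N`, `q ∣ h`, `#H ≥ δN`), a weight `0 ≤ ψ ≤ 1` supported in `(N, 2N]` with shift
bound `|ψ(n+h₁+h₂) − ψ(n)| ≤ w(n)` (`h₁, h₂ ∈ H`, `w ≥ 0`), a region `S ⊇ supp ψ + H + H`, and a phase
`φ : ℤ → ℝ/ℤ` with `‖φ(x+h₁+h₂) − φ(x+h₁) − φ(x+h₂) + φ(x)‖ ≤ ε` whenever the four points lie in `S`
and `q ∣ h₁, h₂`:
`‖Σ_{N<n≤2N} μ(n) ψ(n) e(−φ(n))‖ ≤ C q/√δ · N/log^A N + 6πε Σ ψ + Σ_{(N,2N]} w`.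
(The paper's Bohr-set case is `H = {h ∈ B_g(0,κ) : q ∣ h}`, `δ ≫ κ^{O(1)}/q` by Lemma 14,
`w = O(κ)` on `B_g(n₀, 3ρ)`; the constant is ineffective — Siegel.)
[cite: GreenTao2008QuadraticMobius, Proposition 15] -/
theorem norm_sum_moebius_almost_linear_le {A : ℝ} (hA : 0 < A) :
    ∃ C : ℝ, 0 ≤ C ∧ ∀ N : ℕ, 2 ≤ N → ∀ q : ℕ, 1 ≤ q → ∀ (H : Finset ℤ) (δ : ℝ), 0 < δ →
      δ * N ≤ #H → (0 : ℤ) ∈ H → (∀ h ∈ H, |h| ≤ N ∧ (q : ℤ) ∣ h) →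
      ∀ (ψ w : ℤ → ℝ) (φ : ℤ → UnitAddCircle) (S : Set ℤ) (ε : ℝ),
      (∀ n, 0 ≤ ψ n) → (∀ n, ψ n ≤ 1) → (∀ n, ψ n ≠ 0 → (N : ℤ) < n ∧ n ≤ 2 * N) →
      (∀ n, 0 ≤ w n) → (∀ n, ∀ h₁ ∈ H, ∀ h₂ ∈ H, |ψ (n + h₁ + h₂) - ψ n| ≤ w n) →
      (∀ n, ψ n ≠ 0 → ∀ h₁ ∈ H, ∀ h₂ ∈ H, n + h₁ + h₂ ∈ S) →
      (∀ x h₁ h₂ : ℤ, x ∈ S → x + h₁ ∈ S → x + h₂ ∈ S → x + h₁ + h₂ ∈ S →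
        (q : ℤ) ∣ h₁ → (q : ℤ) ∣ h₂ → ‖φ (x + h₁ + h₂) - φ (x + h₁) - φ (x + h₂) + φ x‖ ≤ ε) →
      ‖∑ n ∈ Ioc N (2 * N),
          ((μ n : ℝ) : ℂ) * ((ψ n : ℝ) : ℂ) * ((AddCircle.toCircle (-φ n) : Circle) : ℂ)‖ ≤
        C * q / Real.sqrt δ * N / Real.log N ^ A +
          6 * Real.pi * ε * ∑ n ∈ Ioc N (2 * N), ψ n + ∑ n ∈ Ioc N (2 * N), w n := by
  obtain ⟨C₀, hC₀⟩ := norm_sum_moebius_block_progression_le hA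
  refine ⟨Real.sqrt 10 * max C₀ 0, by positivity, ?_⟩
  intro N hN q hq H δ hδ hδH h0H hH ψ w φ S ε hψ0 hψ1 hsupp hw0 hw hS hlin
  classical
  have hN1 : 1 ≤ N := by omega
  have hNpos : (0 : ℝ) < N := by exact_mod_cast (by omega : 0 < N)
  have hlog : 0 < Real.log N := Real.log_pos (by exact_mod_cast (by omega : 1 < N))
  have hLA : 0 < Real.log N ^ A := Real.rpow_pos_of_pos hlog A
  haveI : NeZero (10 * N) := ⟨by omega⟩
  set D : ℝ := max C₀ 0 * N / Real.log N ^ A with hDdef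
  have hD0 : 0 ≤ D := by positivity
  have hD : ∀ r : ℕ, ∀ ξ : ZMod (10 * N),
      ‖∑ n ∈ (Ioc N (2 * N)).filter (fun n : ℕ => n % q = r),
        ((μ n : ℝ) : ℂ) * (ZMod.stdAddChar ((n : ZMod (10 * N)) * ξ) : ℂ)‖ ≤ D := by
    intro r ξ
    refine (hC₀ N hN (10 * N) q hq r ξ).trans ?_
    rw [hDdef, div_le_div_iff_of_pos_right hLA]
    exact mul_le_mul_of_nonneg_right (le_max_left _ _) hNpos.le
  -- the estimate on each residue class
  have hclass : ∀ r : ℕ,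
      ‖∑ n ∈ (Ioc N (2 * N)).filter (fun n : ℕ => n % q = r),
          ((μ n : ℝ) : ℂ) * ((ψ n : ℝ) : ℂ) * ((AddCircle.toCircle (-φ n) : Circle) : ℂ)‖ ≤
        (∑ n ∈ (Ioc N (2 * N)).filter (fun n : ℕ => n % q = r), (6 * Real.pi * ε * ψ n + w n)) +
          Real.sqrt (((10 * N : ℕ) : ℝ) / #H) * D :=
    fun r => norm_sum_class_le hN1 (10 * N) le_rfl q r H h0H hH ψ w φ S hψ0 hψ1 hsupp hw0 hw hS
      hlin hD0 (hD r)
  -- `√(10N/#H) ≤ √10/√δ`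
  have hHpos : (0 : ℝ) < #H := lt_of_lt_of_le (mul_pos hδ hNpos) hδH
  have hsq : Real.sqrt (((10 * N : ℕ) : ℝ) / #H) ≤ Real.sqrt 10 / Real.sqrt δ := by
    rw [← Real.sqrt_div (by norm_num : (0 : ℝ) ≤ 10)]
    apply Real.sqrt_le_sqrt
    rw [div_le_div_iff₀ hHpos hδ]
    push_cast
    nlinarith
  -- sum over the residue classes
  rw [sum_Ioc_eq_sum_mod_sum_filter hq N]
  calc ‖∑ r ∈ range q, ∑ n ∈ (Ioc N (2 * N)).filter (fun n : ℕ => n % q = r),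
          ((μ n : ℝ) : ℂ) * ((ψ n : ℝ) : ℂ) * ((AddCircle.toCircle (-φ n) : Circle) : ℂ)‖
      ≤ ∑ r ∈ range q, ‖∑ n ∈ (Ioc N (2 * N)).filter (fun n : ℕ => n % q = r),
          ((μ n : ℝ) : ℂ) * ((ψ n : ℝ) : ℂ) * ((AddCircle.toCircle (-φ n) : Circle) : ℂ)‖ :=
        norm_sum_le _ _
    _ ≤ ∑ r ∈ range q, ((∑ n ∈ (Ioc N (2 * N)).filter (fun n : ℕ => n % q = r),
          (6 * Real.pi * ε * ψ n + w n)) + Real.sqrt (((10 * N : ℕ) : ℝ) / #H) * D) :=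
        Finset.sum_le_sum fun r _ => hclass r
    _ = (∑ n ∈ Ioc N (2 * N), (6 * Real.pi * ε * ψ n + w n)) +
          q * (Real.sqrt (((10 * N : ℕ) : ℝ) / #H) * D) := by
        rw [Finset.sum_add_distrib, Finset.sum_const, card_range, nsmul_eq_mul,
          ← sum_Ioc_eq_sum_mod_sum_filter hq N]
    _ ≤ (∑ n ∈ Ioc N (2 * N), (6 * Real.pi * ε * ψ n + w n)) +
          q * (Real.sqrt 10 / Real.sqrt δ * D) := by
        have : Real.sqrt (((10 * N : ℕ) : ℝ) / #H) * D ≤ Real.sqrt 10 / Real.sqrt δ * D :=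
          mul_le_mul_of_nonneg_right hsq hD0
        have hq0 : (0 : ℝ) ≤ q := Nat.cast_nonneg _
        nlinarith
    _ = Real.sqrt 10 * max C₀ 0 * q / Real.sqrt δ * N / Real.log N ^ A +
          6 * Real.pi * ε * ∑ n ∈ Ioc N (2 * N), ψ n + ∑ n ∈ Ioc N (2 * N), w n := by
        rw [Finset.sum_add_distrib, ← Finset.mul_sum, hDdef]
        ring

end Summit.Parity.GeneralizedHardyLittlewood.GreenTaoLevelTwoMNTwoAlmostLinear
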